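import Literature.NumberTheory.Transcendental.KZRulesAssociator
import Literature.NumberTheory.Transcendental.KZMellinFibres
import Literature.NumberTheory.Transcendental.KZLogCalculusProofs
import Literature.Analysis.SpecialFunctions.SelbergIntegralBasic
import HarnessLib

/-!
# Cube Beta representations are Fubini products (Kontsevich–Zagier calculus)

For exponent data `x y : Fin N → ℚ` call an integral representation `r : KZ.IntegralRep N`
*pinned as the cube Beta representation of `(x, y)`* if

* `r.domain = {t | ∀ j, t j ∈ (0,1)}` (the open unit cube of `ℝᴺ`), and
* `r.integrand = ∏_j (t j)^{x_j − 1} (1 − t j)^{y_j − 1}` ON that domain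

(`[(0,1)ᴺ, ∏_j t_j^{x_j-1}(1-t_j)^{y_j-1}]`, value `∏_j B(x_j, y_j)`; Kontsevich–Zagier 2001,
§1.1, and §4.1: "the product of integrals is again an integral (Fubini formula)"). All
statements below take the two pinning clauses as def-free hypotheses. We prove:

* `KZ.exists_cubeBetaRep` — for positive data such a representation EXISTS (the integrand is an
  Euler–Mellin monomial in the family `(X_j, 1 − X_j)_j`, hence `ℚ`-semialgebraic on the cube by
  `KZ.isSemialgebraicFunOn_mellinIntegrand`; it is integrable as a product of one-variable Beta
  integrands, `MeasureTheory.Integrable.fintype_prod`);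
* `KZ.cubeBetaRep_equivalent` — two representations pinned as the same cube representation are
  `KZ.Equivalent` (one integrand-additivity move);
* `KZ.cubeBetaRep_zero_equivalent_unit` — in dimension `0` a cube representation is equivalent
  to the unit `[pt, 1]` (`KZ.IntegralRep.unit`);
* `KZ.cubeBetaRep_succ_equivalent_prod` (and the `∘`-spelled `…_prod'`) — PEELING: a cube
  representation of `(x, y)` in dimension `N + 1` is equivalent to the Fubini product
  `s.prod r'` of a one-variable Beta representation `s` pinned as `[(0,1), t^{x₀-1}(1-t)^{y₀-1}]`
  with a cube representation `r'` of the tail data `(x ∘ succ, y ∘ succ)`: up to the coordinate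
  relabelling `Fin (N+1) ≃ Fin (1+N)` (a change-of-variables move,
  `KZ.of_sub_of_reindex_mem_relations`) both have the same domain and the same integrand on it
  (`Fin.prod_univ_succ`).

Everything is proved; no `def`, no named fact.
-/

noncomputable section

open MeasureTheory Set
open Literature.ModelTheory.ExponentialFields (IsSemialgebraic)
open MvPolynomial (aeval X C)

namespace Literature.NumberTheory.Transcendental

namespace KZ

variable {N : ℕ}

/-! ## The open unit cube and the cube Beta integrand -/

/-- The open unit cube `(0,1)ᴺ` (coordinate spelling) is the product set `∏ (0,1)`.
[folklore] -/
theorem setOf_forall_apply_mem_Ioo_eq_pi (N : ℕ) :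
    {t : Fin N → ℝ | ∀ j, t j ∈ Set.Ioo (0:ℝ) 1} = Set.pi univ fun _ => Set.Ioo (0:ℝ) 1 := by
  ext t
  simp

/-- The open unit cube is measurable. [folklore] -/
theorem measurableSet_setOf_forall_apply_mem_Ioo (N : ℕ) :
    MeasurableSet {t : Fin N → ℝ | ∀ j, t j ∈ Set.Ioo (0:ℝ) 1} :=
  Literature.ModelTheory.ExponentialFields.IsSemialgebraic.measurableSet_holds
    (isSemialgebraic_box N)

/-- Lebesgue measure restricted to the open unit cube is the product of `N` copies of Lebesgue
measure restricted to `(0,1)`. [folklore] -/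
theorem volume_restrict_setOf_forall_apply_mem_Ioo (N : ℕ) :
    (volume : Measure (Fin N → ℝ)).restrict {t | ∀ j, t j ∈ Set.Ioo (0:ℝ) 1} =
      Measure.pi fun _ : Fin N => (volume : Measure ℝ).restrict (Set.Ioo 0 1) := by
  rw [setOf_forall_apply_mem_Ioo_eq_pi, volume_pi, Measure.restrict_pi_pi]

/-- **The cube Beta integrand `∏_j (t j)^{x_j-1} (1 - t j)^{y_j-1}` is `ℚ`-semialgebraic on the
open unit cube**, for arbitrary rational exponent data: it is the Euler–Mellin monomial of the
family `(X_j)_j ++ (1 − X_j)_j` with exponents `(x_j − 1)_j ++ (y_j − 1)_j`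
(`KZ.isSemialgebraicFunOn_mellinIntegrand`; no Tarski–Seidenberg).
[cite: KontsevichZagier2001, §1.1] -/
theorem isSemialgebraicFunOn_cubeBetaIntegrand (x y : Fin N → ℚ) :
    IsSemialgebraicFunOn ℚ {t : Fin N → ℝ | ∀ j, t j ∈ Set.Ioo (0:ℝ) 1}
      (fun t => ∏ j, (t j) ^ ((x j : ℝ) - 1) * (1 - t j) ^ ((y j : ℝ) - 1)) := by
  refine (isSemialgebraicFunOn_mellinIntegrand (isSemialgebraic_box N)
    (Fin.append (fun j => (X j : MvPolynomial (Fin N) ℚ)) (fun j => 1 - X j))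
    (Fin.append (fun j => x j - 1) (fun j => y j - 1)) 1 (fun t ht k => ?_)).congr fun t _ => ?_
  · induction k using Fin.addCases with
    | left j =>
      rw [Fin.append_left, MvPolynomial.aeval_X]
      exact (ht j).1
    | right j =>
      rw [Fin.append_right, map_sub, map_one, MvPolynomial.aeval_X, sub_pos]
      exact (ht j).2
  · simp only [mellinIntegrand_apply, Rat.cast_one, one_mul, Fin.prod_univ_add, Fin.append_left,
      Fin.append_right, MvPolynomial.aeval_X, map_sub, map_one, Rat.cast_sub,
      Finset.prod_mul_distrib]

/-- **The cube Beta integrand is absolutely integrable on the open unit cube** for positive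
data: a product of one-variable Beta integrands `t^{a-1}(1-t)^{b-1} ∈ L¹(0,1)` (`0 < a, b`) is
integrable for the product measure (Tonelli, `MeasureTheory.Integrable.fintype_prod`).
[cite: KontsevichZagier2001, §4.1] -/
theorem integrableOn_cubeBetaIntegrand (x y : Fin N → ℚ) (hpos : ∀ j, 0 < x j ∧ 0 < y j) :
    IntegrableOn
      (fun t : Fin N → ℝ => ∏ j, (t j) ^ ((x j : ℝ) - 1) * (1 - t j) ^ ((y j : ℝ) - 1))
      {t | ∀ j, t j ∈ Set.Ioo (0:ℝ) 1} := by
  rw [IntegrableOn, volume_restrict_setOf_forall_apply_mem_Ioo]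
  refine Integrable.fintype_prod
    (f := fun j (u : ℝ) => u ^ ((x j : ℝ) - 1) * (1 - u) ^ ((y j : ℝ) - 1)) fun j => ?_
  open Literature.Analysis.SpecialFunctions.Selberg in
  exact (integrableOn_Ioo_rpow_mul_one_sub_rpow_and_integral_eq
    (by exact_mod_cast (hpos j).1) (by exact_mod_cast (hpos j).2)).1

/-! ## Existence, and uniqueness up to one move -/

/-- **Cube Beta representations exist** (C1): for positive rational data `(x, y)` there is an
integral representation pinned as `[(0,1)ᴺ, ∏_j t_j^{x_j-1}(1-t_j)^{y_j-1}]` — the cube is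
`ℚ`-semialgebraic, the integrand is `ℚ`-semialgebraic on it and absolutely integrable.
[cite: KontsevichZagier2001, §1.1] -/
theorem exists_cubeBetaRep (x y : Fin N → ℚ) (hpos : ∀ j, 0 < x j ∧ 0 < y j) :
    ∃ r : IntegralRep N, r.domain = {t | ∀ j, t j ∈ Set.Ioo (0:ℝ) 1} ∧
      Set.EqOn r.integrand
        (fun t => ∏ j, (t j) ^ ((x j : ℝ) - 1) * (1 - t j) ^ ((y j : ℝ) - 1)) r.domain :=
  ⟨⟨_, _, isSemialgebraic_box N, isSemialgebraicFunOn_cubeBetaIntegrand x y,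
    integrableOn_cubeBetaIntegrand x y hpos⟩, rfl, fun _ _ => rfl⟩

/-- **Uniqueness up to one move** (C4): two representations pinned as the same cube Beta
representation are equivalent (same domain, integrands agree on it: integrand additivity
against the zero representation, `KZ.of_sub_of_mem_relations_of_eqOn`).
[cite: KontsevichZagier2001, §1.2 rule (1)] -/
theorem cubeBetaRep_equivalent (x y : Fin N → ℚ) (r r' : IntegralRep N)
    (hrd : r.domain = {t | ∀ j, t j ∈ Set.Ioo (0:ℝ) 1})
    (hri : Set.EqOn r.integrand
      (fun t => ∏ j, (t j) ^ ((x j : ℝ) - 1) * (1 - t j) ^ ((y j : ℝ) - 1)) r.domain)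
    (hr'd : r'.domain = {t | ∀ j, t j ∈ Set.Ioo (0:ℝ) 1})
    (hr'i : Set.EqOn r'.integrand
      (fun t => ∏ j, (t j) ^ ((x j : ℝ) - 1) * (1 - t j) ^ ((y j : ℝ) - 1)) r'.domain) :
    Equivalent r r' :=
  of_sub_of_mem_relations_of_eqOn (hr'd.trans hrd.symm) fun t ht =>
    (hri ht).trans (hr'i (by rw [hr'd]; rw [hrd] at ht; exact ht)).symm

/-! ## Dimension zero: the unit -/

/-- **Dimension zero** (C3): a representation pinned as the cube Beta representation with no
variables (domain `(0,1)⁰ = ℝ⁰ = {pt}`, integrand the empty product `1`) is equivalent to the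
unit representation `[pt, 1]` (one integrand-additivity move).
[cite: KontsevichZagier2001, §4.1] -/
theorem cubeBetaRep_zero_equivalent_unit (x y : Fin 0 → ℚ) (r : IntegralRep 0)
    (hrd : r.domain = {t | ∀ j, t j ∈ Set.Ioo (0:ℝ) 1})
    (hri : Set.EqOn r.integrand
      (fun t => ∏ j, (t j) ^ ((x j : ℝ) - 1) * (1 - t j) ^ ((y j : ℝ) - 1)) r.domain) :
    Equivalent r IntegralRep.unit := by
  refine of_sub_of_mem_relations_of_eqOn ?_ fun t ht => ?_
  · rw [IntegralRep.unit_domain, hrd]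
    ext t
    simp
  · rw [hri ht, IntegralRep.unit_integrand]
    simp

/-! ## Peeling off the first variable: cube = Beta × cube -/

/-- The relabelling `Fin (N+1) ≃ Fin (1+N)` used for peeling sends `0` to the first-block
coordinate of `ℝ¹ × ℝᴺ`. [folklore] -/
theorem finCongr_add_comm_zero (N : ℕ) :
    finCongr (Nat.add_comm N 1) 0 = Fin.castAdd N (0 : Fin 1) :=
  Fin.ext (by simp)

/-- The relabelling `Fin (N+1) ≃ Fin (1+N)` used for peeling sends `succ j` to the `j`-th
coordinate of the second block of `ℝ¹ × ℝᴺ`. [folklore] -/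
theorem finCongr_add_comm_succ (N : ℕ) (j : Fin N) :
    finCongr (Nat.add_comm N 1) j.succ = Fin.natAdd 1 j :=
  Fin.ext (by simp [Nat.add_comm])

/-- **Peeling** (C2): a representation `r` pinned as the cube Beta representation of `(x, y)`
in dimension `N + 1` is equivalent to the Fubini product `s.prod r'` of a representation `s`
pinned as the one-variable Beta representation `[(0,1), t^{x₀-1}(1-t)^{y₀-1}]` (first-coordinate
spelling) with a representation `r'` pinned as the cube Beta representation of the tail data
`(j ↦ x (succ j), j ↦ y (succ j))`. Chain: ONE change of variables (the coordinate relabelling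
`finCongr (Nat.add_comm N 1)`, `KZ.of_sub_of_reindex_mem_relations`), after which the domains
coincide (`(0,1)^{N+1} = (0,1) × (0,1)ᴺ`) and the integrands agree on them
(`Fin.prod_univ_succ`; the integrand of `s.prod r'` is `s ⊗ r'`,
`KZ.IntegralRep.prod_integrand_eq`), then ONE integrand-additivity move
(`KZ.of_sub_of_mem_relations_of_eqOn`). Value identity:
`∏_{j ≤ N} B(x_j,y_j) = B(x₀,y₀) · ∏_{j ≥ 1} B(x_j,y_j)`. [cite: KontsevichZagier2001, §4.1] -/
theorem cubeBetaRep_succ_equivalent_prod (x y : Fin (N + 1) → ℚ) (r : IntegralRep (N + 1))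
    (s : IntegralRep 1) (r' : IntegralRep N)
    (hrd : r.domain = {t | ∀ j, t j ∈ Set.Ioo (0:ℝ) 1})
    (hri : Set.EqOn r.integrand
      (fun t => ∏ j, (t j) ^ ((x j : ℝ) - 1) * (1 - t j) ^ ((y j : ℝ) - 1)) r.domain)
    (hsd : s.domain = {t | t 0 ∈ Set.Ioo (0:ℝ) 1})
    (hsi : Set.EqOn s.integrand
      (fun t => (t 0) ^ ((x 0 : ℝ) - 1) * (1 - t 0) ^ ((y 0 : ℝ) - 1)) s.domain)
    (hr'd : r'.domain = {t | ∀ j, t j ∈ Set.Ioo (0:ℝ) 1})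
    (hr'i : Set.EqOn r'.integrand
      (fun t => ∏ j, (t j) ^ ((x j.succ : ℝ) - 1) * (1 - t j) ^ ((y j.succ : ℝ) - 1))
      r'.domain) :
    Equivalent r (s.prod r') := by
  set e : Fin (N + 1) ≃ Fin (1 + N) := finCongr (Nat.add_comm N 1)
  have he0 : e 0 = Fin.castAdd N (0 : Fin 1) := finCongr_add_comm_zero N
  have hes : ∀ j : Fin N, e j.succ = Fin.natAdd 1 j := finCongr_add_comm_succ N
  -- membership in the relabelled cube, blockwise
  have hmem : ∀ w : Fin (1 + N) → ℝ, w ∈ (r.reindex e).domain ↔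
      w (Fin.castAdd N (0 : Fin 1)) ∈ Set.Ioo (0:ℝ) 1 ∧
        ∀ j : Fin N, w (Fin.natAdd 1 j) ∈ Set.Ioo (0:ℝ) 1 := by
    intro w
    rw [IntegralRep.reindex_domain, mem_setOf_eq, hrd, mem_setOf_eq, Fin.forall_fin_succ]
    dsimp only
    rw [he0]
    simp only [hes]
  -- move 1: the relabelling is a change of variables
  have h1 : of r - of (r.reindex e) ∈ relations := of_sub_of_reindex_mem_relations r e
  -- move 2: same domain, same integrand on it
  have h2 : of (r.reindex e) - of (s.prod r') ∈ relations := by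
    refine of_sub_of_mem_relations_of_eqOn ?_ fun w hw => ?_
    · ext w
      rw [hmem, IntegralRep.prod_domain, IntegralRep.mem_prodDomain, hsd, hr'd]
      rfl
    · obtain ⟨hw0, hw'⟩ := (hmem w).1 hw
      have hws : (fun i : Fin 1 => w (Fin.castAdd N i)) ∈ s.domain := by rw [hsd]; exact hw0
      have hwr' : (fun j : Fin N => w (Fin.natAdd 1 j)) ∈ r'.domain := by rw [hr'd]; exact hw'
      have hwr : (fun i => w (e i)) ∈ r.domain := hw
      rw [IntegralRep.prod_integrand_eq, IntegralRep.prodFun_apply, hsi hws, hr'i hwr',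
        IntegralRep.reindex_integrand]
      dsimp only
      rw [hri hwr]
      dsimp only
      rw [Fin.prod_univ_succ, he0]
      simp only [hes]
  have h := relations.add_mem h1 h2
  rwa [sub_add_sub_cancel] at h

/-- **Peeling, `∘`-spelling** (C2'): as `KZ.cubeBetaRep_succ_equivalent_prod`, with the tail
representation pinned as the cube Beta representation of `(x ∘ Fin.succ, y ∘ Fin.succ)` and the
one-variable factor pinned as the cube Beta representation of the constant data `(x 0, y 0)` in
dimension `1` (cube spelling: `∀ j : Fin 1`, `∏ over Fin 1`). [cite: KontsevichZagier2001, §4.1] -/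
theorem cubeBetaRep_succ_equivalent_prod' (x y : Fin (N + 1) → ℚ) (r : IntegralRep (N + 1))
    (s : IntegralRep 1) (r' : IntegralRep N)
    (hrd : r.domain = {t | ∀ j, t j ∈ Set.Ioo (0:ℝ) 1})
    (hri : Set.EqOn r.integrand
      (fun t => ∏ j, (t j) ^ ((x j : ℝ) - 1) * (1 - t j) ^ ((y j : ℝ) - 1)) r.domain)
    (hsd : s.domain = {t | ∀ j, t j ∈ Set.Ioo (0:ℝ) 1})
    (hsi : Set.EqOn s.integrand
      (fun t => ∏ j, (t j) ^ (((fun _ : Fin 1 => x 0) j : ℝ) - 1) *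
        (1 - t j) ^ (((fun _ : Fin 1 => y 0) j : ℝ) - 1)) s.domain)
    (hr'd : r'.domain = {t | ∀ j, t j ∈ Set.Ioo (0:ℝ) 1})
    (hr'i : Set.EqOn r'.integrand
      (fun t => ∏ j, (t j) ^ (((x ∘ Fin.succ) j : ℝ) - 1) *
        (1 - t j) ^ (((y ∘ Fin.succ) j : ℝ) - 1)) r'.domain) :
    Equivalent r (s.prod r') := by
  refine cubeBetaRep_succ_equivalent_prod x y r s r' hrd hri ?_ (fun t ht => ?_) hr'd hr'i
  · rw [hsd]
    ext t
    simp [Fin.forall_fin_one]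
  · rw [hsi ht]
    simp

end KZ

end Literature.NumberTheory.Transcendental
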